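/-
Copyright (c) 2026 the pub-hodgecm-mathlib formalisation cell (harness21).  Prover seat hodgecm-mathlib-K2E1-p16 (g4), Track B ∕ K2-LIT, h413 = `stmt-HodgeConjecture-24833`,
R90-TF section S8 «ContSpec-n½», socket (E) :276 (N₃) row, S8 dealer R90-CS-plan (g3) S8-R241 (3) (name reserved S8-R189, K2E1-p14 (g4) CENSUS-E4 row (1)): THE `χ_τ`-IDEMPOTENT EDITION
OF ★ D5′ — the K-type projector `e_τ = dim τ • ∫_K conj χ_τ(k) • R(k) dk` for an irreducible `K_∞`-type `τ` of ANY dimension (idempotent, NOT multiplicative) in place of the multiplicative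
character `χ` of the one-dimensional road; census `K2/K2E1-p16/g4/CENSUS-TauIdempotentModel.md`.
-/
import Summits.HodgeConjecture.HodgeConjecture.Theorems.K2E1IrreducibleNoContinuousSpectrumCMTwoOfLetters   -- ★ p860487 D5′ at `U(H)(𝔸_{L⁺})`; brings ★ `K2E1HeckeAlgebraLettersCM`, ★ p860372 `K2E1KTypeProjectorPureTensorU`, ★ p860333, ★ `IntegratedOperatorStar`, ★ p860349
import Literature.RepresentationTheory.CompactGroups.CharacterProjection                                    -- ★ `Schur.charProj` ∕ `charProjL`, `integral_character_mul_character_inv_mul` (II (4.16)(iii)), `character_inv`, `finrank_smul_integral_conj_character_smul_apply`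
import HarnessLib

/-!
# R90-TF · S8 «ContSpec-n½» — `R90S8ResGIsotypicTauIdempotentModelU3`: THE `χ_τ`-IDEMPOTENT EDITION OF ★ D5′ (K-types of any dimension: CONVOLUTION IDEMPOTENCE replaces multiplicativity)

Cell `hodgecm-mathlib`, crux H413 (`stmt-HodgeConjecture-24833`, lane `--supports … --as helper`), route of record `HCCMUnconditional`; R90-TF section S8, socket (E) `sock_S8_res_exhaustion_le_closure`
(B ED. 7 :276) via ★ `res_exhaustion_le_closure_of_record`, whose (N₃) row is PAID PER `K_∞`-TYPE τ and glued (★ `R90S8ResGIsotypicKTypeGlueU3.hNblk_of_kTypes`; K-TYPE CURRENCY FLAG, S8-R189).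
THEOREMS ONLY (no `def`, no `instance`, no `notation`, no named-fact hypothesis, no `sorry`; default heartbeats); count-neutral; CLOSES NO SOCKET; pays no letter by itself.

THE MATHEMATICS ([BrockerTomDieck1985] II (4.16), III (5.4)–(5.5), (5.9)–(5.10); [DeitmarEchterhoff2014] Prop. 6.2.1, Prop. 7.3.3, §7.4; [Knapp1986] VIII §3).  ★ D5′ («an irreducible closed
summand `W` of a unitary representation of `U(H)(𝔸_{L⁺})` has no continuous spectrum at the block») runs on the BLOCK PROJECTOR `P = P_χ ∘L R_f(e)`, `P_χ = ∫_K χ(k) R(ι_∞ κ k) dμ_K`, and in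
the whole chain ★ p860349 → ★ p860487 → ★ p862453 §1 → ★ `resG_isotypic_le_orthogonal_of_lineModel` the hypotheses `hχmul : χ(kl) = χ(k)χ(l)`, `hχone : χ(1) = 1` enter at ONE place: ★
p860372 `kType_comp_self` (`P_χ ∘L P_χ = P_χ`, feeding `hPV`), while `hχinv : conj χ(k⁻¹) = χ(k)` feeds self-adjointness (`hPsa`).  For a `K_∞`-type `τ` of dimension `> 1` (`K_∞ ≅ U(2) × U(1)` is
non-abelian) the right kernel is the `χ_τ`-IDEMPOTENT `χ_τ♮ := dim τ • conj χ_τ` — NOT multiplicative, but a CONVOLUTION IDEMPOTENT: `χ_τ♮ ⋆ χ_τ♮ = χ_τ♮` by II (4.16)(iii)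
`χ_τ ⋆ χ_τ = χ_τ ∕ dim τ` (★ `Schur.integral_character_mul_character_inv_mul`), and `conj χ_τ♮(k⁻¹) = χ_τ♮(k)` by `χ_τ(k⁻¹) = conj χ_τ(k)` (★ `Schur.character_inv`).  So the χ_τ-edition of D5′ is
D5′ with `(hχmul, hχone)` replaced by the single hypothesis **`hχconv : ∀ x, χ x = mulConv μ χ χ x`** — satisfied by every multiplicative `χ` with `χ(1) = 1` (§2 `mulConv_eq_self_of_mul`) AND
by `χ_τ♮` (§1 `tauIdem_mulConv`) — through ★ `integratedOperator_comp_integratedOperator` (`π(f₁) π(f₂) = π(f₁ ⋆ f₂)`).  The operator `P_{χ_τ♮} = R_K(χ_τ♮)` IS Literature's character projector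
★ `Schur.charProj μ τ` (`e_τ v = dim τ • ∫ conj χ_τ(k) • R(k) v dk`, §1 `integratedOperator_apply_eq_charProj`), whence BY NAME: continuity (★ `charProjL`), `K`-equivariance (★ `apply_charProj`),
self-adjointness (★ `inner_charProj_comm`), «`= id` on the closed τ-isotypic span» (★ `charProj_eq_self_of_mem_closure`, ★ `charProj_apply_of_comm`), «`= 0` on every `σ ≇ τ` piece» (★
`charProj_apply_of_comm_eq_zero`); commutation with the finite-adelic level idempotent `R_f(e)` is ★ p860372 `kType_comm_integratedOperator` (NO hypothesis on `χ`).
* §1 GENERIC compact `K`, probability left-invariant `μ`, irreducible unitary continuous finite-dimensional `τ`, and ANY `χ : C_c(K, ℂ)` with `hχτ : χ k = dim τ * conj χ_τ(k)`: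
  `exists_compactlySupported_tauIdem` (such a `χ` exists), `tauIdem_conj_inv` (`hχinv`), **`tauIdem_mulConv`** (`hχconv`), **`integratedOperator_apply_eq_charProj`** (JUNCTION with ★ `Schur.charProj` for
  ANY unitary strongly continuous `U` of `K`), `integratedOperator_tauIdem_apply_of_comm` (= id on images of `K`-maps `τ → U`), `integratedOperator_tauIdem_apply_eq_zero_of_comm` (= 0 on `σ ≇ τ`).
* §2 ★ p860372's two-factor frame (`ι₁ : G₁ →* G`, `ι₂ : G₂ →* G` commuting, `κ : K →* G₁`): `mulConv_eq_self_of_mul` (the multiplicative road is a special case), **`kType_comp_self_of_conv`**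
  (`P_χ ∘L P_χ = P_χ` from `hχconv`), **`blockProjector_idem_of_conv`** (`(P_χ ∘L R₂ e)² = P_χ ∘L R₂ e`).
* §3 AT ★ `cmDatum L N H` (every `N`, every `H`): **`cm_blockProjector_hPV_of_conv`** and the CONV-EDITIONS of ★ D5′-cm **`indicator_lpSMul_blockProj_eq_zero_of_irreducible_subrep_cm_of_conv`** ∕
  **`lpModel_blockProj_eq_zero_of_irreducible_subrep_cm_of_conv`** — ★ p860487's statements with `(hχmul, hχone)` replaced by `hχconv` (bodies unchanged but for `hPV`); at `χ := χ_τ♮` these are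
  the D5′ inputs of the (N₃) per-τ letter for `dim τ > 1` (FILE B: conv-editions of ★ p862453 §1 ∕ ★ `resG_isotypic_le_orthogonal_of_lineModel`, same visible bill minus `hχmul hχone`).
INSTANCE FRAME (honest): as ★ D5′-cm (`[MeasurableSpace K] [BorelSpace K] (μ) [IsProbabilityMeasure] [IsMulLeftInvariant] [IsInvInvariant] [MeasurableMul] [MeasurableInv]`) PLUS
`[IsTopologicalGroup K] [SecondCountableTopology K]` for the convolution lemma; at `K := ↥(archMaximalCompact L)` all are supplied by ★ `R90S8ArchMaximalCompactPlacewiseU3` (compactness) +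
★ `secondCountableTopology_adelic` + `borelize` + `haarMeasure ⊤` (cf. ★ `R90S8ArchMaximalCompactTransposeRealisationU3.exists_forall_homSpace_archTorus_eq_smul`'s preamble).
HONEST LABEL: HC_CM is proved only modulo the 7 printed citations (2 remaining named inputs: hLiu418 = `stmt-HodgeConjecture-24832`, h413 = `stmt-HodgeConjecture-24833`) until rung 0
closes; no multiplicativity is claimed for `χ_τ♮` (false for `dim τ > 1`); the range identification «`P_τ v ∈ N_τ` for every `v`» (Peter–Weyl half) is NOT in this file; REL ≠ ★ ≠ BUILT; this
file asserts no named fact, is conditional by construction on D5′'s visible model letters, and closes no socket; count-neutral.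

## References
* [BrockerTomDieck1985] T. Bröcker, T. tom Dieck, *Representations of Compact Lie Groups*, GTM 98 (1985), II (4.16), III (5.4), (5.5), (5.9)–(5.10).
* [DeitmarEchterhoff2014] A. Deitmar, S. Echterhoff, *Principles of Harmonic Analysis* (2nd ed., 2014), Prop. 6.2.1, Lemma 6.1.7, Prop. 7.3.3, §7.4.
* [Knapp1986] A. W. Knapp, *Representation Theory of Semisimple Groups* (1986), VIII §3 (`E_τ = d_τ ∫_K conj χ_τ(k) π(k) dk`).
* [MoeglinWaldspurger1995] C. Mœglin, J.-L. Waldspurger, *Spectral Decomposition and Eisenstein Series* (1995), IV.3.12 (b), VI.2 (the D5′ statement).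
-/

set_option autoImplicit false
set_option linter.dupNamespace false  -- the mandated namespace `…HodgeConjecture.HodgeConjecture.R90.S8` (LEAD #1 L1) repeats the summit's segment

noncomputable section

open MeasureTheory Filter Topology CompactlySupported NumberField ContRepresentation Set
open scoped InnerProductSpace ENNReal ComplexConjugate
open Literature.NumberTheory.Automorphic Literature.NumberTheory.Automorphic.UnitaryGroup AdelicGroupData
open Literature.RepresentationTheory.CompactGroups
open Summit.HodgeConjecture.HodgeConjecture.Cruxes.H413.K2E1IrreducibleNoContinuousSpectrumU (indicator_lpSMul_proj_eq_zero_of_irreducible_subrep)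
open Summit.HodgeConjecture.HodgeConjecture.Cruxes.H413.K2E1HeckeAlgebraLettersCM
open Summit.HodgeConjecture.HodgeConjecture.Cruxes.H413.K2E1PureTensorHeckeAlgebraU (cm_comp_pureTensor_mem cm_adjoint_pureTensor_mem)
open Summit.HodgeConjecture.HodgeConjecture.Cruxes.H413.K2E1ZeroOneLawSpectralSupport (indicator_lpSMul_eq_self_iff)
open Summit.HodgeConjecture.HodgeConjecture.Cruxes.H413

namespace Summit.HodgeConjecture.HodgeConjecture.R90.S8

/-! ## §1 The `χ_τ`-idempotent `χ_τ♮ = dim τ • conj χ_τ` of an irreducible unitary `K`-type `τ`: `hχinv`, CONVOLUTION IDEMPOTENCE `hχconv`, and the junction with ★ `Schur.charProj` -/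

section TauIdem

variable {K : Type*} [Group K] [TopologicalSpace K] [IsTopologicalGroup K] [MeasurableSpace K] [BorelSpace K] [CompactSpace K]
  {E : Type*} [NormedAddCommGroup E] [InnerProductSpace ℂ E] [FiniteDimensional ℂ E]
  (μ : Measure K) [IsProbabilityMeasure μ] [μ.IsMulLeftInvariant]
  (τ : ContRepresentation ℂ K E)

omit [IsTopologicalGroup K] [MeasurableSpace K] [BorelSpace K] [IsProbabilityMeasure μ] [μ.IsMulLeftInvariant] in
/-- **The `χ_τ`-idempotent exists as a test function**: on a compact group the continuous function `χ_τ♮ := dim τ • conj χ_τ` has compact support (★ `Schur.continuous_character`).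
[cite: BrockerTomDieck1985, III (5.9)] -/
theorem exists_compactlySupported_tauIdem (hτc : Continuous (τ : K → E →L[ℂ] E)) :
    ∃ χ : C_c(K, ℂ), ∀ k, χ k = (Module.finrank ℂ E : ℂ) * conj (Schur.character τ k) :=
  ⟨⟨⟨fun k => (Module.finrank ℂ E : ℂ) * conj (Schur.character τ k), continuous_const.mul (Complex.continuous_conj.comp (Schur.continuous_character hτc))⟩,
    HasCompactSupport.of_compactSpace _⟩, fun _ => rfl⟩

omit [TopologicalSpace K] [IsTopologicalGroup K] [MeasurableSpace K] [BorelSpace K] [CompactSpace K] [IsProbabilityMeasure μ] [μ.IsMulLeftInvariant] in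
/-- **`hχinv` for `χ_τ♮`**: `conj χ_τ♮(k⁻¹) = χ_τ♮(k)` for a unitary `τ` (`χ_τ(k⁻¹) = conj χ_τ(k)`, ★ `Schur.character_inv`) — so ★ p860372 `adjoint_kType` and ★ `cm_blockProjector_hPsa` apply to `χ_τ♮`
BY NAME. [cite: BrockerTomDieck1985, II Prop (4.10)] [cite: DeitmarEchterhoff2014, Prop. 6.2.1] -/
theorem tauIdem_conj_inv [TopologicalSpace K] (hτu : ∀ (k : K) (v w : E), ⟪τ k v, τ k w⟫_ℂ = ⟪v, w⟫_ℂ) {χ : C_c(K, ℂ)}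
    (hχτ : ∀ k, χ k = (Module.finrank ℂ E : ℂ) * conj (Schur.character τ k)) (k : K) : conj (χ k⁻¹) = χ k := by
  rw [hχτ, hχτ, map_mul, Complex.conj_natCast, Schur.character_inv hτu, Complex.conj_conj]

/-- **CONVOLUTION IDEMPOTENCE `hχconv` for `χ_τ♮`**: `χ_τ♮ = χ_τ♮ ⋆ χ_τ♮`, i.e. `χ_τ♮(x) = ∫ χ_τ♮(u) χ_τ♮(u⁻¹ x) dμ(u)` — Bröcker–tom Dieck II (4.16)(iii) `χ_τ ⋆ χ_τ = χ_τ ∕ dim τ`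
(★ `Schur.integral_character_mul_character_inv_mul`), conjugated and scaled by `(dim τ)²`. [cite: BrockerTomDieck1985, II Prop (4.16)] [cite: DeitmarEchterhoff2014, Prop. 7.3.3] -/
theorem tauIdem_mulConv (hτc : Continuous (τ : K → E →L[ℂ] E)) [τ.toRepresentation.IsIrreducible] (hτu : ∀ (k : K) (v w : E), ⟪τ k v, τ k w⟫_ℂ = ⟪v, w⟫_ℂ) {χ : C_c(K, ℂ)}
    (hχτ : ∀ k, χ k = (Module.finrank ℂ E : ℂ) * conj (Schur.character τ k)) (x : K) : χ x = mulConv μ (⇑χ) (⇑χ) x := by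
  have hd : (Module.finrank ℂ E : ℂ) ≠ 0 := Schur.finrank_ne_zero_of_isIrreducible τ
  rw [mulConv_apply]
  have h1 : (fun u => χ u * χ (u⁻¹ * x)) = fun u => ((Module.finrank ℂ E : ℂ) * (Module.finrank ℂ E : ℂ)) * conj (Schur.character τ u * Schur.character τ (u⁻¹ * x)) := by
    funext u
    rw [hχτ, hχτ, map_mul]
    ring
  rw [h1, integral_const_mul, integral_conj, Schur.integral_character_mul_character_inv_mul μ hτc hτu x, hχτ, map_div₀, Complex.conj_natCast]
  field_simp

variable {H : Type*} [NormedAddCommGroup H] [InnerProductSpace ℂ H] [CompleteSpace H]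

omit [IsTopologicalGroup K] [CompactSpace K] [FiniteDimensional ℂ E] [μ.IsMulLeftInvariant] in
/-- **JUNCTION: `R_K(χ_τ♮) = e_τ`** — the integrated operator of `χ_τ♮` on ANY unitary strongly continuous representation `ρ` of `K` IS ★ `Schur.charProj μ τ ρ` (`dim τ • ∫ conj χ_τ(k) • ρ k v dμ`);
hence continuity (★ `charProjL`), `K`-equivariance (★ `apply_charProj`), self-adjointness (★ `inner_charProj_comm`) and the isotypic calculus hold for `R_K(χ_τ♮)` BY NAME. [cite: BrockerTomDieck1985, III (5.10)]
[cite: Knapp1986, VIII §3] -/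
theorem integratedOperator_apply_eq_charProj (ρ : ContRepresentation ℂ K H) (hρu : ρ.IsUnitary) (hρc : ρ.IsStronglyContinuous) {χ : C_c(K, ℂ)}
    (hχτ : ∀ k, χ k = (Module.finrank ℂ E : ℂ) * conj (Schur.character τ k)) (v : H) :
    ρ.integratedOperator hρu hρc μ χ v = Schur.charProj μ τ ρ v := by
  rw [ContRepresentation.integratedOperator_apply, Schur.charProj_def, ← integral_smul]
  refine integral_congr_ae (Filter.Eventually.of_forall fun k => ?_)
  beta_reduce
  rw [hχτ, mul_smul]

omit [IsProbabilityMeasure μ] [μ.IsMulLeftInvariant] in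
/-- **`R_K(χ_τ♮) = id` on the image of every `K`-map `τ → ρ`** (★ `Schur.charProj_apply_of_comm` through the junction): the τ-isotypic vectors are FIXED — the «range ⊇ N_τ» half and the `hScP`-type
input of the (N₃) per-τ road. [cite: BrockerTomDieck1985, III (5.10)] -/
theorem integratedOperator_tauIdem_apply_of_comm [IsProbabilityMeasure μ] [μ.IsMulLeftInvariant] (hτc : Continuous (τ : K → E →L[ℂ] E)) [τ.toRepresentation.IsIrreducible]
    (hτu : ∀ (k : K) (v w : E), ⟪τ k v, τ k w⟫_ℂ = ⟪v, w⟫_ℂ) {χ : C_c(K, ℂ)} (hχτ : ∀ k, χ k = (Module.finrank ℂ E : ℂ) * conj (Schur.character τ k))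
    (ρ : ContRepresentation ℂ K H) (hρu : ρ.IsUnitary) (hρc : ρ.IsStronglyContinuous) (T : E →L[ℂ] H) (hT : ∀ k : K, (ρ k).comp T = T.comp (τ k)) (x : E) :
    ρ.integratedOperator hρu hρc μ χ (T x) = T x := by
  rw [integratedOperator_apply_eq_charProj μ τ ρ hρu hρc hχτ]
  exact Schur.charProj_apply_of_comm μ hτc hτu T hT x

omit [IsProbabilityMeasure μ] [μ.IsMulLeftInvariant] in
/-- **`R_K(χ_τ♮) = 0` on the image of every `K`-map `σ → ρ` from an irreducible unitary `σ ≇ τ`** (★ `Schur.charProj_apply_of_comm_eq_zero` through the junction): the other `K`-types are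
KILLED. [cite: BrockerTomDieck1985, III (5.10)] [cite: BrockerTomDieck1985, II Prop (4.16)] -/
theorem integratedOperator_tauIdem_apply_eq_zero_of_comm [IsProbabilityMeasure μ] [μ.IsMulLeftInvariant] {F : Type*} [NormedAddCommGroup F] [InnerProductSpace ℂ F] [FiniteDimensional ℂ F]
    {σ : ContRepresentation ℂ K F} (hτc : Continuous (τ : K → E →L[ℂ] E)) (hσc : Continuous (σ : K → F →L[ℂ] F)) [τ.toRepresentation.IsIrreducible]
    [σ.toRepresentation.IsIrreducible] (hne : IsEmpty (τ.toRepresentation.Equiv σ.toRepresentation)) (hτu : ∀ (k : K) (v w : E), ⟪τ k v, τ k w⟫_ℂ = ⟪v, w⟫_ℂ)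
    {χ : C_c(K, ℂ)} (hχτ : ∀ k, χ k = (Module.finrank ℂ E : ℂ) * conj (Schur.character τ k)) (ρ : ContRepresentation ℂ K H) (hρu : ρ.IsUnitary) (hρc : ρ.IsStronglyContinuous)
    (S : F →L[ℂ] H) (hS : ∀ k : K, (ρ k).comp S = S.comp (σ k)) (y : F) :
    ρ.integratedOperator hρu hρc μ χ (S y) = 0 := by
  rw [integratedOperator_apply_eq_charProj μ τ ρ hρu hρc hχτ]
  exact Schur.charProj_apply_of_comm_eq_zero μ hτc hσc hne hτu S hS y

end TauIdem

/-! ## §2 ★ p860372's two-factor frame: `P_χ ∘L P_χ = P_χ` FROM CONVOLUTION IDEMPOTENCE, and the block projector `P_χ ∘L R₂ e` is idempotent -/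

section TwoFactor

variable {G G₁ G₂ K V : Type*} [Group G] [TopologicalSpace G]
  [Group G₁] [TopologicalSpace G₁]
  [Group G₂] [TopologicalSpace G₂] [MeasurableSpace G₂] [BorelSpace G₂]
  [Group K] [TopologicalSpace K] [IsTopologicalGroup K] [MeasurableSpace K] [BorelSpace K] [SecondCountableTopology K]
  [NormedAddCommGroup V] [InnerProductSpace ℂ V] [CompleteSpace V]
  (π : ContRepresentation ℂ G V) (hu : π.IsUnitary) (hc : π.IsStronglyContinuous)
  (ι₁ : G₁ →* G) (hι₁ : Continuous ι₁) (ι₂ : G₂ →* G) (hι₂ : Continuous ι₂) (κ : K →* G₁) (hκ : Continuous κ)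
  (η₂ : Measure G₂) [IsFiniteMeasureOnCompacts η₂]
  (μ : Measure K) [IsFiniteMeasureOnCompacts μ] (χ : C_c(K, ℂ))

omit [IsTopologicalGroup K] [BorelSpace K] [SecondCountableTopology K] [IsFiniteMeasureOnCompacts μ] in
/-- **The multiplicative road is a special case**: a multiplicative `χ` on a probability space is a convolution idempotent, `χ = χ ⋆ χ` (`χ(u)χ(u⁻¹x) = χ(x)`; `χ(1) = 1` is not even needed).
[cite: Knapp1986, VIII §3] -/
theorem mulConv_eq_self_of_mul [IsProbabilityMeasure μ] (hχmul : ∀ k l, χ (k * l) = χ k * χ l) (x : K) : χ x = mulConv μ (⇑χ) (⇑χ) x := by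
  rw [mulConv_apply]
  have h : (fun u => χ u * χ (u⁻¹ * x)) = fun _ => χ x := by
    funext u
    rw [← hχmul, mul_inv_cancel_left]
  rw [h, integral_const, probReal_univ, one_smul]

/-- **`P_χ ∘L P_χ = P_χ` FROM CONVOLUTION IDEMPOTENCE** `χ = χ ⋆ χ` (★ `integratedOperator_comp_integratedOperator`: `π(f₁) π(f₂) = π(f₁ ⋆ f₂)`; `μ` left-invariant, s-finite, `K` second countable) — the
χ_τ-edition of ★ p860372 `kType_comp_self` (at `χ := χ_τ♮`, §1 `tauIdem_mulConv`). [cite: DeitmarEchterhoff2014, Prop. 6.2.1] [cite: Knapp1986, VIII §3] -/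
theorem kType_comp_self_of_conv [SFinite μ] [μ.IsMulLeftInvariant] (hχconv : ∀ x, χ x = mulConv μ (⇑χ) (⇑χ) x) :
    (π.restrict (ι₁.comp κ)).integratedOperator (hu.restrict (ι₁.comp κ)) (hc.restrict (ι₁.comp κ) (hι₁.comp hκ)) μ χ ∘L
        (π.restrict (ι₁.comp κ)).integratedOperator (hu.restrict (ι₁.comp κ)) (hc.restrict (ι₁.comp κ) (hι₁.comp hκ)) μ χ =
      (π.restrict (ι₁.comp κ)).integratedOperator (hu.restrict (ι₁.comp κ)) (hc.restrict (ι₁.comp κ) (hι₁.comp hκ)) μ χ :=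
  ContRepresentation.integratedOperator_comp_integratedOperator (hu.restrict (ι₁.comp κ)) (hc.restrict (ι₁.comp κ) (hι₁.comp hκ)) μ χ χ χ hχconv

/-- **THE BLOCK PROJECTOR `P_χ ∘L R₂ e` IS IDEMPOTENT** for a convolution-idempotent `χ`: `P_χ` idempotent (`kType_comp_self_of_conv`), `R₂ e` idempotent (★ `level_comp_self`), and they commute (★
`kType_comm_integratedOperator`, no hypothesis on `χ`) — the χ_τ-edition of ★ `blockProjector_idem`. [cite: Knapp1986, VIII §3] [cite: DeitmarEchterhoff2014, §7.4] -/
theorem blockProjector_idem_of_conv [SFinite μ] [μ.IsMulLeftInvariant] [MeasurableMul G₂] [η₂.IsMulLeftInvariant]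
    (hcomm : ∀ (x : G₁) (y : G₂), ι₁ x * ι₂ y = ι₂ y * ι₁ x) (hχconv : ∀ x, χ x = mulConv μ (⇑χ) (⇑χ) x)
    (K' : Subgroup G₂) (e : C_c(G₂, ℂ)) (he0 : ∀ x, x ∉ K' → e x = 0) (he1 : ∫ x, e x ∂η₂ = 1) (heK : ∀ k ∈ K', ∀ x, e (k * x) = e x) :
    ((π.restrict (ι₁.comp κ)).integratedOperator (hu.restrict (ι₁.comp κ)) (hc.restrict (ι₁.comp κ) (hι₁.comp hκ)) μ χ ∘L
        (π.restrict ι₂).integratedOperator (hu.restrict ι₂) (hc.restrict ι₂ hι₂) η₂ e) ∘L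
      ((π.restrict (ι₁.comp κ)).integratedOperator (hu.restrict (ι₁.comp κ)) (hc.restrict (ι₁.comp κ) (hι₁.comp hκ)) μ χ ∘L
        (π.restrict ι₂).integratedOperator (hu.restrict ι₂) (hc.restrict ι₂ hι₂) η₂ e) =
      (π.restrict (ι₁.comp κ)).integratedOperator (hu.restrict (ι₁.comp κ)) (hc.restrict (ι₁.comp κ) (hι₁.comp hκ)) μ χ ∘L
        (π.restrict ι₂).integratedOperator (hu.restrict ι₂) (hc.restrict ι₂ hι₂) η₂ e :=
  comp_idem_of_commute _ _ (kType_comp_self_of_conv π hu hc ι₁ hι₁ κ hκ μ χ hχconv)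
    (K2E1KTypeProjectorPureTensorU.level_comp_self (π.restrict ι₂) (hu.restrict ι₂) (hc.restrict ι₂ hι₂) η₂ K' e he0 he1 heK)
    (K2E1KTypeProjectorPureTensorU.kType_comm_integratedOperator π hu hc ι₁ hι₁ ι₂ κ hκ μ χ hι₂ η₂ hcomm e)

end TwoFactor

/-! ## §3 At `U(H)(𝔸_{L⁺}) = (cmDatum L N H).Adelic` (every `N`, every `H`): `hPV` and the CONV-EDITIONS of ★ D5′-cm -/

section CM

variable {L : Type} [Field L] [NumberField L] [IsCMField L] {N : ℕ} {H : Matrix (Fin N) (Fin N) L}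
  {K V : Type*} [Group K] [TopologicalSpace K] [IsTopologicalGroup K] [MeasurableSpace K] [BorelSpace K] [SecondCountableTopology K]
  [NormedAddCommGroup V] [InnerProductSpace ℂ V] [CompleteSpace V]
  (π : ContRepresentation ℂ (cmDatum L N H).Adelic V) (hu : π.IsUnitary) (hc : π.IsStronglyContinuous)
  [MeasurableSpace (UnitaryGroup.arch (↥(maximalRealSubfield L)) L (IsCMField.complexConj L) N H)] [BorelSpace (UnitaryGroup.arch (↥(maximalRealSubfield L)) L (IsCMField.complexConj L) N H)]
  [MeasurableSpace (finAdelic (↥(maximalRealSubfield L)) L (IsCMField.complexConj L) N H)] [BorelSpace (finAdelic (↥(maximalRealSubfield L)) L (IsCMField.complexConj L) N H)]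
  (νinf : Measure (UnitaryGroup.arch (↥(maximalRealSubfield L)) L (IsCMField.complexConj L) N H)) [IsFiniteMeasureOnCompacts νinf] [νinf.IsMulLeftInvariant] [νinf.IsInvInvariant] [νinf.IsOpenPosMeasure]
  (νf : Measure (finAdelic (↥(maximalRealSubfield L)) L (IsCMField.complexConj L) N H)) [IsFiniteMeasureOnCompacts νf] [νf.IsMulLeftInvariant] [νf.IsInvInvariant] [νf.IsOpenPosMeasure]
  (κ : K →* UnitaryGroup.arch (↥(maximalRealSubfield L)) L (IsCMField.complexConj L) N H) (hκ : Continuous κ)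
  (μ : Measure K) [IsFiniteMeasureOnCompacts μ] [IsProbabilityMeasure μ] [μ.IsMulLeftInvariant] [MeasurableInv K] [μ.IsInvInvariant]
  (χ : C_c(K, ℂ)) (e : C_c(finAdelic (↥(maximalRealSubfield L)) L (IsCMField.complexConj L) N H, ℂ))
  {Ω : Type*} {mΩ : MeasurableSpace Ω} {m : Measure Ω} {E : Type*} [NormedAddCommGroup E] [NormedSpace ℂ E] {J : Type*} [Countable J]
variable [ENNReal.HolderTriple ∞ 2 2]

omit [MeasurableSpace (UnitaryGroup.arch (↥(maximalRealSubfield L)) L (IsCMField.complexConj L) N H)] [BorelSpace (UnitaryGroup.arch (↥(maximalRealSubfield L)) L (IsCMField.complexConj L) N H)]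
  [IsFiniteMeasureOnCompacts νinf] [νinf.IsMulLeftInvariant] [νinf.IsInvInvariant] [νinf.IsOpenPosMeasure] [νf.IsInvInvariant] [νf.IsOpenPosMeasure] [MeasurableInv K] [μ.IsInvInvariant]
  [ENNReal.HolderTriple ∞ 2 2] in
/-- **`hPV` AT `U(H)(𝔸_{L⁺})`, CONVOLUTION EDITION**: for a convolution-idempotent `χ` (e.g. `χ_τ♮`) and a level idempotent kernel `e = e_{K′}`, the block projector `P = P_χ ∘L R_f(e)` maps into
`V = {v | P v = v}` (§2 `blockProjector_idem_of_conv`, ★ `cm_hcomm`) — the χ_τ-edition of ★ `cm_blockProjector_hPV`. [cite: Knapp1986, VIII §3] [cite: DeitmarEchterhoff2014, §7.4] -/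
theorem cm_blockProjector_hPV_of_conv (hχconv : ∀ x, χ x = mulConv μ (⇑χ) (⇑χ) x)
    (K' : Subgroup (finAdelic (↥(maximalRealSubfield L)) L (IsCMField.complexConj L) N H)) (he0 : ∀ x, x ∉ K' → e x = 0) (he1 : ∫ x, e x ∂νf = 1)
    (heK : ∀ k ∈ K', ∀ x, e (k * x) = e x) (x : V) :
    ((π.restrict ((archToAdelic (↥(maximalRealSubfield L)) L (IsCMField.complexConj L) N H).comp κ)).integratedOperator (hu.restrict _)
          (hc.restrict _ ((continuous_archToAdelic (↥(maximalRealSubfield L)) L (IsCMField.complexConj L) N H).comp hκ)) μ χ ∘L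
        (π.restrict (finAdelicToAdelic (↥(maximalRealSubfield L)) L (IsCMField.complexConj L) N H)).integratedOperator (hu.restrict _)
          (hc.restrict _ (continuous_finAdelicToAdelic (↥(maximalRealSubfield L)) L (IsCMField.complexConj L) N H)) νf e) x ∈
      LinearMap.eqLocus (((π.restrict ((archToAdelic (↥(maximalRealSubfield L)) L (IsCMField.complexConj L) N H).comp κ)).integratedOperator (hu.restrict _)
          (hc.restrict _ ((continuous_archToAdelic (↥(maximalRealSubfield L)) L (IsCMField.complexConj L) N H).comp hκ)) μ χ ∘L
        (π.restrict (finAdelicToAdelic (↥(maximalRealSubfield L)) L (IsCMField.complexConj L) N H)).integratedOperator (hu.restrict _)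
          (hc.restrict _ (continuous_finAdelicToAdelic (↥(maximalRealSubfield L)) L (IsCMField.complexConj L) N H)) νf e : V →L[ℂ] V) : V →ₗ[ℂ] V) LinearMap.id :=
  mem_eqLocus_of_idem _ (blockProjector_idem_of_conv π hu hc _ (continuous_archToAdelic (↥(maximalRealSubfield L)) L (IsCMField.complexConj L) N H)
    _ (continuous_finAdelicToAdelic (↥(maximalRealSubfield L)) L (IsCMField.complexConj L) N H) κ hκ νf μ χ
    (K2E1PureTensorHeckeAlgebraU.cm_hcomm) hχconv K' e he0 he1 heK) x

/-- **★ D5′ PROPER AT `U(H)(𝔸_{L⁺})`, CONVOLUTION EDITION** (general line part `Λ`): ★ p860487 `indicator_lpSMul_blockProj_eq_zero_of_irreducible_subrep_cm` with `(hχmul, hχone)` REPLACED by the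
convolution idempotence `hχconv` (so `χ := χ_τ♮` for a `K_∞`-type `τ` of any dimension is admissible, §1): for every topologically irreducible closed `W ≤ V` and `w ∈ W`, **`𝟙_Λ • U (P w) = 0`**.
Body = ★'s, with `hPV := cm_blockProjector_hPV_of_conv`. [cite: MoeglinWaldspurger1995, IV.3.12, VI.2] [cite: DeitmarEchterhoff2014, Lemma 6.1.7] -/
theorem indicator_lpSMul_blockProj_eq_zero_of_irreducible_subrep_cm_of_conv
    (hχconv : ∀ x, χ x = mulConv μ (⇑χ) (⇑χ) x) (hχinv : ∀ k, conj (χ k⁻¹) = χ k)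
    (K' : Subgroup (finAdelic (↥(maximalRealSubfield L)) L (IsCMField.complexConj L) N H)) (he0 : ∀ x, x ∉ K' → e x = 0) (he1 : ∫ x, e x ∂νf = 1)
    (heK : ∀ k ∈ K', ∀ x, e (k * x) = e x) (hestar : ∀ x, mulStar (⇑e) x = e x)
    (P : V →L[ℂ] V) (hPdef : P = ((π.restrict ((archToAdelic (↥(maximalRealSubfield L)) L (IsCMField.complexConj L) N H).comp κ)).integratedOperator (hu.restrict _)
          (hc.restrict _ ((continuous_archToAdelic (↥(maximalRealSubfield L)) L (IsCMField.complexConj L) N H).comp hκ)) μ χ ∘L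
        (π.restrict (finAdelicToAdelic (↥(maximalRealSubfield L)) L (IsCMField.complexConj L) N H)).integratedOperator (hu.restrict _) (hc.restrict _ (continuous_finAdelicToAdelic (↥(maximalRealSubfield L)) L (IsCMField.complexConj L) N H)) νf e))
    (W : ClosedSubrep π) (hW : W.toContRep.IsTopIrreducible)
    (T : J → V →L[ℂ] V) (hT𝓐 : ∀ j, T j ∈ {A : V →L[ℂ] V | ∃ (a : C_c(UnitaryGroup.arch (↥(maximalRealSubfield L)) L (IsCMField.complexConj L) N H, ℂ)) (b : C_c(finAdelic (↥(maximalRealSubfield L)) L (IsCMField.complexConj L) N H, ℂ)),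
      A = (π.restrict (archToAdelic (↥(maximalRealSubfield L)) L (IsCMField.complexConj L) N H)).integratedOperator (hu.restrict _) (hc.restrict _ (continuous_archToAdelic (↥(maximalRealSubfield L)) L (IsCMField.complexConj L) N H)) νinf a ∘L
          (π.restrict (finAdelicToAdelic (↥(maximalRealSubfield L)) L (IsCMField.complexConj L) N H)).integratedOperator (hu.restrict _) (hc.restrict _ (continuous_finAdelicToAdelic (↥(maximalRealSubfield L)) L (IsCMField.complexConj L) N H)) νf b})
    (hTP : ∀ j, Commute P (T j))
    (hTB : ∀ j, ∀ A ∈ {A : V →L[ℂ] V | ∃ (a : C_c(UnitaryGroup.arch (↥(maximalRealSubfield L)) L (IsCMField.complexConj L) N H, ℂ)) (b : C_c(finAdelic (↥(maximalRealSubfield L)) L (IsCMField.complexConj L) N H, ℂ)),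
      A = (π.restrict (archToAdelic (↥(maximalRealSubfield L)) L (IsCMField.complexConj L) N H)).integratedOperator (hu.restrict _) (hc.restrict _ (continuous_archToAdelic (↥(maximalRealSubfield L)) L (IsCMField.complexConj L) N H)) νinf a ∘L
          (π.restrict (finAdelicToAdelic (↥(maximalRealSubfield L)) L (IsCMField.complexConj L) N H)).integratedOperator (hu.restrict _) (hc.restrict _ (continuous_finAdelicToAdelic (↥(maximalRealSubfield L)) L (IsCMField.complexConj L) N H)) νf b},
      ∀ x ∈ LinearMap.eqLocus (P : V →ₗ[ℂ] V) LinearMap.id, P (A (T j x)) = T j (P (A x)))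
    (U : V →ₗ[ℂ] Lp E 2 m) (s : J → Ω → ℂ) (hs : ∀ j, MemLp (s j) ∞ m)
    (hU : ∀ j, ∀ v ∈ LinearMap.eqLocus (P : V →ₗ[ℂ] V) LinearMap.id, U (T j v) = (hs j).toLp (s j) • U v)
    {Λ : Set Ω} (hΛ : MeasurableSet Λ) (hline : ∀ c : J → ℂ, m (Λ ∩ {x | ∀ j, s j x = c j}) = 0) (hΛ1 : MemLp (Λ.indicator fun _ : Ω => (1 : ℂ)) ∞ m)
    {w : V} (hw : w ∈ W) :
    (hΛ1.toLp (Λ.indicator fun _ : Ω => (1 : ℂ)) • U (P w) : Lp E 2 m) = 0 := by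
  have hPV : ∀ x, P x ∈ LinearMap.eqLocus (P : V →ₗ[ℂ] V) LinearMap.id := fun x => by
    subst hPdef
    exact cm_blockProjector_hPV_of_conv π hu hc νf κ hκ μ χ e hχconv K' he0 he1 heK x
  have hPid : ∀ v ∈ LinearMap.eqLocus (P : V →ₗ[ℂ] V) LinearMap.id, P v = v := fun v hv => apply_eq_of_mem_eqLocus P v hv
  have hPsa : ∀ x y : V, ⟪P x, y⟫_ℂ = ⟪x, P y⟫_ℂ := fun x y => by
    subst hPdef
    exact cm_blockProjector_hPsa π hu hc νf κ hκ μ χ e hχinv hestar x y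
  have hPW : ∀ w ∈ W, P w ∈ W := fun w hw => by
    subst hPdef
    exact cm_blockProjector_hPW π hu hc νf κ hκ μ χ e W w hw
  have hTV : ∀ j, ∀ x ∈ LinearMap.eqLocus (P : V →ₗ[ℂ] V) LinearMap.id, T j x ∈ LinearMap.eqLocus (P : V →ₗ[ℂ] V) LinearMap.id := fun j x hx => by
    have h := congrArg (fun S : V →L[ℂ] V => S x) (hTP j).eq
    change P (T j x) = T j (P x) at h
    rw [hPid x hx] at h
    exact h
  have hTW : ∀ j, ∀ w ∈ W, T j w ∈ W := fun j w hw => cm_pureTensor_apply_mem π hu hc νinf νf W (T j) (hT𝓐 j) w hw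
  exact indicator_lpSMul_proj_eq_zero_of_irreducible_subrep W hW (cm_comp_pureTensor_mem π hu hc νinf νf) (cm_pureTensor_nondegenerate π hu hc νinf νf)
    (cm_adjoint_pureTensor_mem π hu hc νinf νf) (cm_pureTensor_apply_mem π hu hc νinf νf W)
    (LinearMap.eqLocus (P : V →ₗ[ℂ] V) LinearMap.id) (isClosed_eqLocus_id P) P hPV hPid hPsa hPW T hTV hTW hTB U s hs hU hΛ hline hΛ1 hw

/-- **`Λ = univ`: THE LINE COORDINATE VANISHES, CONVOLUTION EDITION** — `U (P w) = 0` for every vector of every irreducible closed summand, ★ p860487 `lpModel_blockProj_eq_zero_of_irreducible_subrep_cm`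
with `(hχmul, hχone)` replaced by `hχconv`; at `χ := χ_τ♮` (§1) this is D5′ at a `K_∞`-type of ANY dimension. [cite: MoeglinWaldspurger1995, IV.3.12, VI.2] -/
theorem lpModel_blockProj_eq_zero_of_irreducible_subrep_cm_of_conv
    (hχconv : ∀ x, χ x = mulConv μ (⇑χ) (⇑χ) x) (hχinv : ∀ k, conj (χ k⁻¹) = χ k)
    (K' : Subgroup (finAdelic (↥(maximalRealSubfield L)) L (IsCMField.complexConj L) N H)) (he0 : ∀ x, x ∉ K' → e x = 0) (he1 : ∫ x, e x ∂νf = 1)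
    (heK : ∀ k ∈ K', ∀ x, e (k * x) = e x) (hestar : ∀ x, mulStar (⇑e) x = e x)
    (P : V →L[ℂ] V) (hPdef : P = ((π.restrict ((archToAdelic (↥(maximalRealSubfield L)) L (IsCMField.complexConj L) N H).comp κ)).integratedOperator (hu.restrict _)
          (hc.restrict _ ((continuous_archToAdelic (↥(maximalRealSubfield L)) L (IsCMField.complexConj L) N H).comp hκ)) μ χ ∘L
        (π.restrict (finAdelicToAdelic (↥(maximalRealSubfield L)) L (IsCMField.complexConj L) N H)).integratedOperator (hu.restrict _) (hc.restrict _ (continuous_finAdelicToAdelic (↥(maximalRealSubfield L)) L (IsCMField.complexConj L) N H)) νf e))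
    (W : ClosedSubrep π) (hW : W.toContRep.IsTopIrreducible)
    (T : J → V →L[ℂ] V) (hT𝓐 : ∀ j, T j ∈ {A : V →L[ℂ] V | ∃ (a : C_c(UnitaryGroup.arch (↥(maximalRealSubfield L)) L (IsCMField.complexConj L) N H, ℂ)) (b : C_c(finAdelic (↥(maximalRealSubfield L)) L (IsCMField.complexConj L) N H, ℂ)),
      A = (π.restrict (archToAdelic (↥(maximalRealSubfield L)) L (IsCMField.complexConj L) N H)).integratedOperator (hu.restrict _) (hc.restrict _ (continuous_archToAdelic (↥(maximalRealSubfield L)) L (IsCMField.complexConj L) N H)) νinf a ∘L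
          (π.restrict (finAdelicToAdelic (↥(maximalRealSubfield L)) L (IsCMField.complexConj L) N H)).integratedOperator (hu.restrict _) (hc.restrict _ (continuous_finAdelicToAdelic (↥(maximalRealSubfield L)) L (IsCMField.complexConj L) N H)) νf b})
    (hTP : ∀ j, Commute P (T j))
    (hTB : ∀ j, ∀ A ∈ {A : V →L[ℂ] V | ∃ (a : C_c(UnitaryGroup.arch (↥(maximalRealSubfield L)) L (IsCMField.complexConj L) N H, ℂ)) (b : C_c(finAdelic (↥(maximalRealSubfield L)) L (IsCMField.complexConj L) N H, ℂ)),
      A = (π.restrict (archToAdelic (↥(maximalRealSubfield L)) L (IsCMField.complexConj L) N H)).integratedOperator (hu.restrict _) (hc.restrict _ (continuous_archToAdelic (↥(maximalRealSubfield L)) L (IsCMField.complexConj L) N H)) νinf a ∘L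
          (π.restrict (finAdelicToAdelic (↥(maximalRealSubfield L)) L (IsCMField.complexConj L) N H)).integratedOperator (hu.restrict _) (hc.restrict _ (continuous_finAdelicToAdelic (↥(maximalRealSubfield L)) L (IsCMField.complexConj L) N H)) νf b},
      ∀ x ∈ LinearMap.eqLocus (P : V →ₗ[ℂ] V) LinearMap.id, P (A (T j x)) = T j (P (A x)))
    (U : V →ₗ[ℂ] Lp E 2 m) (s : J → Ω → ℂ) (hs : ∀ j, MemLp (s j) ∞ m)
    (hU : ∀ j, ∀ v ∈ LinearMap.eqLocus (P : V →ₗ[ℂ] V) LinearMap.id, U (T j v) = (hs j).toLp (s j) • U v)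
    (hline : ∀ c : J → ℂ, m {x | ∀ j, s j x = c j} = 0) {w : V} (hw : w ∈ W) :
    U (P w) = 0 := by
  have h1 : MemLp ((univ : Set Ω).indicator fun _ : Ω => (1 : ℂ)) ∞ m := (memLp_top_const (1 : ℂ)).indicator MeasurableSet.univ
  have h := indicator_lpSMul_blockProj_eq_zero_of_irreducible_subrep_cm_of_conv π hu hc νinf νf κ hκ μ χ e hχconv hχinv K' he0 he1 heK hestar P hPdef W hW T hT𝓐 hTP hTB U s hs hU
    MeasurableSet.univ (fun c => by rw [univ_inter]; exact hline c) h1 hw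
  have hself : (h1.toLp ((univ : Set Ω).indicator fun _ : Ω => (1 : ℂ)) • U (P w) : Lp E 2 m) = U (P w) := by
    rw [indicator_lpSMul_eq_self_iff (U (P w)) MeasurableSet.univ h1, compl_univ, Measure.restrict_empty]
    rw [Filter.EventuallyEq, ae_zero]
    exact Filter.eventually_bot
  rw [← hself]
  exact h

end CM

end Summit.HodgeConjecture.HodgeConjecture.R90.S8

end
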